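import Literature.Probability.RandomPlanarGeometry.SLEPointFlowStopped
import Literature.Probability.RandomPlanarGeometry.HypergeometricHalfODE
import Literature.Analysis.FunctionSpaces.ItoProductRule
import Literature.Analysis.FunctionSpaces.ItoMartingale
import HarnessLib

/-!
# Rohde–Schramm's observable `ψₜ^a Ĝ_{a,κ}(zₜ)` stopped before swallowing is a martingale (Itô step)

Topic `Probability/RandomPlanarGeometry`; theorems only. This file proves the stochastic-calculus
core of Rohde–Schramm (2005), Lemma 6.3 — "A direct application of Itô's formula shows that
`Mₜ := (ŷ |gₜ'(ẑ)|/yₜ)^a Ĝ(zₜ)` is a local martingale" (p. 904), "there is an increasing sequence of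
stopping times `tₙ < τ(ẑ)` with `limₙ tₙ = τ(ẑ)` a.s. such that `M_{t∧tₙ}` is a martingale" (p. 905)
— in the following form (`martingale_stoppedProcess_sleRSObservableGen`): for `κ > 0`, any real
exponent `a` with `32aκ + (2κ-8)² ≥ 0` (real parameters `η₀, η₁`, so that
`Literature.Probability.RandomPlanarGeometry.rsGhat a κ` is the printed `Ĝ_{a,κ}`), `z ∈ ℍ`, and
any stopping time `σ` of the raw Brownian filtration dominated by a localizing time
`ρₙ = slePointLocTime κ z n` (`SLEPointFlow`) along which the slope `|wₜ| = |xₜ/yₜ|` stays bounded,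
the stopped observable `t ↦ ψ_{t∧σ}^a Ĝ_{a,κ}(z_{t∧σ})` is a martingale under the pre-Wiener
measure. Both units consuming Lemma 6.3 use it: `κ ≥ 8` (`a = a(κ) < 0`, `σ = T ∧ ρₙ` with `T` the
exit time of `|w|` from `[0, s)`, file `SLEDerivRatioMartingaleProofs`) and `κ < 8` (`a` near
`1 - κ/8`, `σ = ρₙ`).

## Proof

With `h = rsGhatSlope a κ` (`Ĝ_{a,κ}(x + iy) = h(x/y)`, `HypergeometricHalfODE`) and the stopped
processes `x = x^σ`, `y = y^σ`, `ψ = ψ^σ` of `SLEPointFlowStopped`: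
`x` is an Itô process `dx = 𝟙(2x/|z|²) dt + 𝟙(-√κ) dB` (`isItoProcess_stoppedProcess_slePointRe`),
`1/y = 1/y₀ + ∫ 𝟙 2/(y|z|²)` and `ψ^a = 1 + ∫ 𝟙 a ψ^a 4y²/|z|⁴` are of finite variation; the product
rule (`Literature.Analysis.FunctionSpaces.IsItoProcess.mul_timeIntegral`) makes `w = x · (1/y)` an
Itô process with `dw = 𝟙 4w/|z|² dt - 𝟙 (√κ/y) dB`; Itô's formula
(`Literature.Analysis.FunctionSpaces.ito_formula_itoProcess_ae`, proved in the tree) makes `h(w)` an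
Itô process; the product rule again (`ae_mul_eq_of_isItoProcess`) gives
`d(ψ^a h(w)) = (ψ^a/y²)[(κ/2)h'' + (4w/(1+w²))h' + (4a/(1+w²)²)h](w) 𝟙 dt - 𝟙 ψ^a h'(w)(√κ/y) dB`,
whose drift vanishes identically by the hypergeometric equation (6.9)
(`rsGhatSlope_ode'`: "Since `Ĝ` satisfies `(4ay²/|z|⁴)Ĝ + (κ/2)∂ₓ²Ĝ + (4x/|z|²)∂ₓĜ = 0`", p. 906).
All Itô integrands are bounded and progressive on `[0, σ]` (`y ≥ im z/(n+2)`, `|w| ≤ S`,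
`1 ≤ ψ ≤ exp(4(n+1)(n+2)²/(im z)²)`), so the stochastic integrals are square-integrable martingales of
the raw filtration (`Literature.Probability.Process.exists_isItoIntegral_of_sq_integrable`) and the
stopped observable, being adapted and a.s. equal to `Ĝ(z) +` such an integral, is a martingale.

## References

* S. Rohde, O. Schramm, *Basic properties of SLE*, Ann. of Math. 161 (2005), proof of Lemma 6.3
  (pp. 904–906), eq. (6.3), (6.9).
* D. Revuz, M. Yor, *Continuous Martingales and Brownian Motion* (1999), Ch. IV, Prop. (3.1),
  Thm (3.3).
-/

noncomputable section

open Set Filter MeasureTheory Complex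
open _root_.Topology
open scoped NNReal ENNReal

namespace Literature.Probability.RandomPlanarGeometry

open Loewner Literature.Probability.Process Literature.Analysis.FunctionSpaces

/-! ### Two helpers: bounded progressive integrands -/

section Helpers

/-- **A bounded progressive integrand has a square-integrable (martingale) Itô integral** against
the canonical Brownian motion (`exists_isItoIntegral_of_sq_integrable` with the trivial bound
`∫₀ᵗ H² ≤ C² t`). Revuz–Yor (1999), Ch. IV, Thm (2.2), Prop. (2.8). [cite: RevuzYor1999, Ch. IV Thm (2.2)] -/
theorem exists_isItoIntegral_of_abs_le {H : ℝ≥0 → (ℝ≥0 → ℝ) → ℝ}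
    (hH : IsStronglyProgressive brownianFiltration H) {C : ℝ} (hC : ∀ t ω, |H t ω| ≤ C) :
    ∃ J : ℝ≥0 → (ℝ≥0 → ℝ) → ℝ, IsItoIntegral H brownian J brownianFiltration preWienerMeasure ∧
      Martingale J brownianFiltration preWienerMeasure := by
  haveI := isProbabilityMeasure_preWienerMeasure'
  have hfin : ∀ t : ℝ≥0, ∫⁻ ω, (∫⁻ s in Set.Icc (0 : ℝ) t, ENNReal.ofReal
      (H s.toNNReal ω ^ 2)) ∂preWienerMeasure ≠ ∞ := by
    intro t
    have hle : ∀ ω : ℝ≥0 → ℝ, (∫⁻ s in Set.Icc (0 : ℝ) t, ENNReal.ofReal (H s.toNNReal ω ^ 2)) ≤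
        ENNReal.ofReal (C ^ 2) * volume (Set.Icc (0 : ℝ) t) := by
      intro ω
      rw [← setLIntegral_const]
      refine lintegral_mono fun s ↦ ENNReal.ofReal_le_ofReal ?_
      rw [← sq_abs]
      exact pow_le_pow_left₀ (abs_nonneg _) (hC _ ω) 2
    refine ne_top_of_le_ne_top ?_ (lintegral_mono hle)
    rw [lintegral_const, measure_univ, mul_one, Real.volume_Icc, sub_zero]
    exact ENNReal.mul_ne_top ENNReal.ofReal_ne_top ENNReal.ofReal_ne_top
  obtain ⟨J, hJ, hJM, -⟩ := exists_isItoIntegral_of_sq_integrable hH hfin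
  exact ⟨J, hJ, hJM⟩

/-- The paths of a bounded progressive process are integrable on compact time intervals. [folklore] -/
theorem integrableOn_Icc_of_abs_le {H : ℝ≥0 → (ℝ≥0 → ℝ) → ℝ}
    (hH : IsStronglyProgressive brownianFiltration H) {C : ℝ} (hC : ∀ t ω, |H t ω| ≤ C)
    (ω : ℝ≥0 → ℝ) (t : ℝ≥0) : IntegrableOn (fun s : ℝ ↦ H s.toNNReal ω) (Set.Icc 0 t) := by
  refine Measure.integrableOn_of_bounded (M := C) measure_Icc_lt_top.ne
    (measurable_path_of_isStronglyProgressive hH ω).aestronglyMeasurable ?_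
  exact ae_of_all _ fun s ↦ by rw [Real.norm_eq_abs]; exact hC _ ω

end Helpers

/-! ### The drift of `ψ^a Ĝ(z)` vanishes: the algebra behind (6.9) -/

section Drift

/-- **The Itô drift of `ψ^a h(x/y)` vanishes** given the ODE (6.9) for `h` at the slope `w = x/y`:
with `dx = (2x/|z|²)dt - √κ dB`, `d(1/y) = 2/(y|z|²) dt`, `d(ψ^a) = aψ^a (4y²/|z|⁴) dt`,
`dw = x d(1/y) + (1/y) dx`, the `dt`-coefficient of `d(ψ^a h(w))`,
`h(w)·aψ^a·4y²/|z|⁴ + ψ^a[(x·2/(y|z|²) + (1/y)·2x/|z|²) h'(w) + ½ (√κ/y)² h''(w)]`, equals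
`(ψ^a/y²)[(κ/2)h'' + (4w/(1+w²))h' + (4a/(1+w²)²)h](w) = 0` (`|z|² = y²(1+w²)`).
[cite: RohdeSchramm2005, Lemma 6.3 (proof)] -/
theorem rsObservable_itoDrift_eq_zero (κ : ℝ≥0) {a x y ψa : ℝ} {h : ℝ → ℝ} (hy : y ≠ 0)
    (hode : (κ : ℝ) / 2 * iteratedDeriv 2 h (x * y⁻¹) +
      4 * (x * y⁻¹) / (1 + (x * y⁻¹) ^ 2) * deriv h (x * y⁻¹) +
      4 * a / (1 + (x * y⁻¹) ^ 2) ^ 2 * h (x * y⁻¹) = 0) :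
    h (x * y⁻¹) * (a * loewnerLogDerivRate x y * ψa) +
      ψa * ((x * loewnerInvImDrift x y + y⁻¹ * loewnerReDrift x y) * deriv h (x * y⁻¹) +
        2⁻¹ * (-Real.sqrt κ * y⁻¹) ^ 2 * iteratedDeriv 2 h (x * y⁻¹)) = 0 := by
  obtain ⟨w, rfl⟩ : ∃ w, x = w * y := ⟨x * y⁻¹, by field_simp⟩
  have hw : w * y * y⁻¹ = w := mul_inv_cancel_right₀ hy w
  rw [hw] at hode ⊢
  set h0 := h w
  set h1 := deriv h w
  set h2 := iteratedDeriv 2 h w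
  have h1w : (1 + w ^ 2) ≠ 0 := by positivity
  have hsq : (-Real.sqrt κ * y⁻¹) ^ 2 = (κ : ℝ) * y⁻¹ ^ 2 := by
    rw [mul_pow, neg_sq, Real.sq_sqrt κ.coe_nonneg]
  have key : h0 * (a * loewnerLogDerivRate (w * y) y * ψa) +
      ψa * ((w * y * loewnerInvImDrift (w * y) y + y⁻¹ * loewnerReDrift (w * y) y) * h1 +
        2⁻¹ * (-Real.sqrt κ * y⁻¹) ^ 2 * h2) =
      ψa / y ^ 2 * ((κ : ℝ) / 2 * h2 + 4 * w / (1 + w ^ 2) * h1 + 4 * a / (1 + w ^ 2) ^ 2 * h0) := by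
    rw [hsq, loewnerLogDerivRate_apply, loewnerInvImDrift_apply, loewnerReDrift_apply]
    have hN : (w * y) ^ 2 + y ^ 2 = y ^ 2 * (1 + w ^ 2) := by ring
    rw [hN]
    field_simp
    ring
  rw [key, hode, mul_zero]

end Drift

/-! ### The stopped observable is a martingale -/

section Main

variable {κ : ℝ≥0} {z : ℂ} {n : ℕ} {σ : (ℝ≥0 → ℝ) → WithTop ℝ≥0}

/-- **Rohde–Schramm's observable stopped before swallowing is a martingale** (the Itô step of
Lemma 6.3, both phases). Let `κ > 0`, `a ∈ ℝ` with `32aκ + (2κ-8)² ≥ 0`, `z ∈ ℍ`, and let `σ` be a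
stopping time of the raw Brownian filtration with `σ ≤ ρₙ = slePointLocTime κ z n` such that the
slope `|w_t| = |x_t/y_t|` of `z_t = g_t(z) - √κ B_t` is bounded by `S` on `[0, σ]`. Then
`t ↦ M_{t∧σ} = ψ_{t∧σ}^a Ĝ_{a,κ}(z_{t∧σ})` (`sleRSObservable`, whose cut-off at `τ(z)` is never
reached since `σ ≤ ρₙ < τ(z)`) is a martingale under the pre-Wiener measure.
"A direct application of Itô's formula shows that `Mₜ` is a local martingale … `M_{t∧tₙ}` is a
martingale" (pp. 904–905); the drift vanishes by (6.9) (`rsGhatSlope_ode'`), see the module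
docstring for the chain of tree lemmas. [cite: RohdeSchramm2005, Lemma 6.3 (proof)] -/
theorem martingale_stoppedProcess_sleRSObservable_of_le_locTime (hκ : 0 < κ) {a : ℝ}
    (hdisc : 0 ≤ 32 * a * (κ : ℝ) + (2 * (κ : ℝ) - 8) ^ 2) (hz : 0 < z.im)
    (hσ : IsStoppingTime brownianFiltration σ) (hσρ : ∀ ω, σ ω ≤ slePointLocTime κ z n ω)
    {S : ℝ} (hS : ∀ (ω : ℝ≥0 → ℝ) (t : ℝ≥0), (t : WithTop ℝ≥0) ≤ σ ω →
      |cotArg (sleDriving κ ω) z t| ≤ S) :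
    Martingale (stoppedProcess (sleRSObservable κ a z) σ) brownianFiltration preWienerMeasure := by
  haveI := isProbabilityMeasure_preWienerMeasure'
  have hκ0 : (0 : ℝ) < κ := by exact_mod_cast hκ
  have hσ' : ∀ t : ℝ≥0, MeasurableSet[brownianFiltration t] {ω | σ ω < t} :=
    fun t ↦ hσ.measurableSet_lt t
  have hl0 : 0 < z.im / (n + 2) := (level_pos_lt hz n).1
  -- the processes
  set X : ℝ≥0 → (ℝ≥0 → ℝ) → ℝ := stoppedProcess (slePointRe κ z) σ with hXdef
  set Y : ℝ≥0 → (ℝ≥0 → ℝ) → ℝ := stoppedProcess (slePointIm κ z) σ with hYdef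
  set A : ℝ≥0 → (ℝ≥0 → ℝ) → ℝ := fun t ω ↦ (Y t ω)⁻¹ with hAdef
  set w : ℝ≥0 → (ℝ≥0 → ℝ) → ℝ := fun t ω ↦ X t ω * A t ω with hwdef
  set P : ℝ≥0 → (ℝ≥0 → ℝ) → ℝ := stoppedProcess (slePointPsi κ z) σ with hPdef
  set Ψ : ℝ≥0 → (ℝ≥0 → ℝ) → ℝ := fun t ω ↦ P t ω ^ a with hΨdef
  set h : ℝ → ℝ := rsGhatSlope a κ with hhdef
  set σB : ℝ≥0 → (ℝ≥0 → ℝ) → ℝ := trunc σ (fun _ _ ↦ -Real.sqrt κ) with hσBdef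
  set bX : ℝ≥0 → (ℝ≥0 → ℝ) → ℝ := trunc σ (fun s ω ↦ loewnerReDrift (X s ω) (Y s ω)) with hbXdef
  set aA : ℝ≥0 → (ℝ≥0 → ℝ) → ℝ := trunc σ (fun s ω ↦ loewnerInvImDrift (X s ω) (Y s ω)) with haAdef
  set aΨ : ℝ≥0 → (ℝ≥0 → ℝ) → ℝ :=
    trunc σ (fun s ω ↦ a * loewnerLogDerivRate (X s ω) (Y s ω) * Ψ s ω) with haΨdef
  set bw : ℝ≥0 → (ℝ≥0 → ℝ) → ℝ := fun t ω ↦ X t ω * aA t ω + A t ω * bX t ω with hbwdef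
  set σw : ℝ≥0 → (ℝ≥0 → ℝ) → ℝ := fun t ω ↦ σB t ω * A t ω with hσwdef
  set D1 : ℝ≥0 → (ℝ≥0 → ℝ) → ℝ := fun t ω ↦
    bw t ω * deriv h (w t ω) + 2⁻¹ * σw t ω ^ 2 * iteratedDeriv 2 h (w t ω) with hD1def
  set σG : ℝ≥0 → (ℝ≥0 → ℝ) → ℝ := fun t ω ↦ σw t ω * deriv h (w t ω) with hσGdef
  -- pathwise values and bounds
  have hYpos : ∀ t ω, 0 < Y t ω := fun t ω ↦ stoppedProcess_slePointIm_pos hz hσρ t ω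
  have hYlev : ∀ t ω, z.im / (n + 2) ≤ Y t ω := fun t ω ↦ level_le_stoppedProcess_slePointIm hz hσρ t ω
  have hYle : ∀ t ω, Y t ω ≤ z.im := fun t ω ↦ stoppedProcess_slePointIm_le hz hσρ t ω
  have hwcot : ∀ t ω, w t ω = cotArg (sleDriving κ ω) z ((min (t : WithTop ℝ≥0) (σ ω)).untopA) :=
    fun t ω ↦ by rw [← stopped_div_eq_cotArg hz hσρ t ω, div_eq_mul_inv]
  have hwS : ∀ t ω, |w t ω| ≤ S := fun t ω ↦ by
    rw [hwcot]; exact hS ω _ (coe_untopA_min_le t (σ ω))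
  have hS0 : 0 ≤ S := (abs_nonneg _).trans (hwS 0 fun _ ↦ 0)
  have hwmem : ∀ t ω, w t ω ∈ Icc (-S) S := fun t ω ↦ abs_le.1 (hwS t ω)
  have hXbd : ∀ t ω, |X t ω| ≤ S * z.im := fun t ω ↦ by
    have hx : X t ω = w t ω * Y t ω := by
      simp only [hwdef, hAdef]; rw [inv_mul_cancel_right₀ (hYpos t ω).ne']
    rw [hx, abs_mul, abs_of_pos (hYpos t ω)]
    exact mul_le_mul (hwS t ω) (hYle t ω) (hYpos t ω).le hS0
  have hAbd : ∀ t ω, |A t ω| ≤ (n + 2) / z.im := fun t ω ↦ by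
    simp only [hAdef]
    rw [abs_of_pos (inv_pos.2 (hYpos t ω)), inv_eq_one_div, div_le_div_iff₀ (hYpos t ω) hz, one_mul]
    have := hYlev t ω
    rw [div_le_iff₀ (by positivity : (0 : ℝ) < n + 2)] at this
    linarith
  have hσBbd : ∀ t ω, |σB t ω| ≤ Real.sqrt κ := fun t ω ↦ by
    simp only [hσBdef, trunc_apply]
    split_ifs
    · rw [abs_neg, abs_of_nonneg (Real.sqrt_nonneg _)]
    · rw [abs_zero]; exact Real.sqrt_nonneg _
  set CΨ : ℝ := Real.exp (4 / (z.im / (n + 2)) ^ 2 * ((n : ℝ) + 1)) ^ |a| with hCΨdef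
  have hΨbd : ∀ t ω, |Ψ t ω| ≤ CΨ := fun t ω ↦ stoppedProcess_slePointPsi_rpow_le hz hσρ a t ω
  have hΨpos : ∀ t ω, 0 < Ψ t ω := fun t ω ↦
    Real.rpow_pos_of_pos (lt_of_lt_of_le one_pos (one_le_stoppedProcess_slePointPsi hz hσρ t ω)) a
  -- bounds for `h, h', h''` on `[-S, S]`
  have hcont : ContDiff ℝ 2 h := contDiff_rsGhatSlope a κ
  have hc0 : Continuous h := hcont.continuous
  have hc1 : Continuous (deriv h) := hcont.continuous_deriv (by norm_num)
  have hc2 : Continuous (iteratedDeriv 2 h) := hcont.continuous_iteratedDeriv 2 le_rfl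
  obtain ⟨C0, hC0⟩ : ∃ C, ∀ v ∈ Icc (-S) S, |h v| ≤ C := by
    obtain ⟨C, hC⟩ := isCompact_Icc.exists_bound_of_continuousOn hc0.continuousOn
    exact ⟨C, fun v hv ↦ by simpa [Real.norm_eq_abs] using hC v hv⟩
  obtain ⟨C1, hC1⟩ : ∃ C, ∀ v ∈ Icc (-S) S, |deriv h v| ≤ C := by
    obtain ⟨C, hC⟩ := isCompact_Icc.exists_bound_of_continuousOn hc1.continuousOn
    exact ⟨C, fun v hv ↦ by simpa [Real.norm_eq_abs] using hC v hv⟩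
  have hC00 : 0 ≤ C0 := (abs_nonneg _).trans (hC0 _ (hwmem 0 fun _ ↦ 0))
  have hC10 : 0 ≤ C1 := (abs_nonneg _).trans (hC1 _ (hwmem 0 fun _ ↦ 0))
  -- path regularity
  have hXc : ∀ ω, Continuous (X · ω) := fun ω ↦ continuous_stoppedProcess_slePointRe hz hσρ ω
  have hYc : ∀ ω, Continuous (Y · ω) := fun ω ↦ continuous_stoppedProcess_slePointIm hz σ ω
  have hAc : ∀ ω, Continuous (A · ω) := fun ω ↦ (hYc ω).inv₀ fun t ↦ (hYpos t ω).ne'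
  have hwc : ∀ ω, Continuous (w · ω) := fun ω ↦ (hXc ω).mul (hAc ω)
  have hPc : ∀ ω, Continuous (P · ω) := fun ω ↦ continuous_stoppedProcess_slePointPsi hz hσρ ω
  have hΨc : ∀ ω, Continuous (Ψ · ω) := fun ω ↦ continuous_stoppedProcess_slePointPsi_rpow hz hσρ a ω
  have hGc : ∀ ω, Continuous (fun t ↦ h (w t ω)) := fun ω ↦ hc0.comp (hwc ω)
  -- adaptedness and progressive measurability
  have hXa : StronglyAdapted brownianFiltration X := stronglyAdapted_stoppedProcess_slePointRe hz hσ
  have hYa : StronglyAdapted brownianFiltration Y := stronglyAdapted_stoppedProcess_slePointIm hz hσ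
  have hAa : StronglyAdapted brownianFiltration A := fun t ↦ (hYa t).measurable.inv.stronglyMeasurable
  have hwa : StronglyAdapted brownianFiltration w := fun t ↦ (hXa t).mul (hAa t)
  have hΨa : StronglyAdapted brownianFiltration Ψ :=
    stronglyAdapted_stoppedProcess_slePointPsi_rpow hz hσ hσρ a
  have hGa : StronglyAdapted brownianFiltration fun t ω ↦ h (w t ω) := fun t ↦
    hc0.comp_stronglyMeasurable (hwa t)
  have hXp : IsStronglyProgressive brownianFiltration X := hXa.isStronglyProgressive_of_continuous hXc
  have hYp : IsStronglyProgressive brownianFiltration Y := hYa.isStronglyProgressive_of_continuous hYc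
  have hAp : IsStronglyProgressive brownianFiltration A := hAa.isStronglyProgressive_of_continuous hAc
  have hwp : IsStronglyProgressive brownianFiltration w := hXp.mul hAp
  have hΨp : IsStronglyProgressive brownianFiltration Ψ := hΨa.isStronglyProgressive_of_continuous hΨc
  have hGp : IsStronglyProgressive brownianFiltration fun t ω ↦ h (w t ω) :=
    IsStronglyProgressive.continuous_comp hwp hc0
  have hG1p : IsStronglyProgressive brownianFiltration fun t ω ↦ deriv h (w t ω) :=
    IsStronglyProgressive.continuous_comp hwp hc1
  have hσBp : IsStronglyProgressive brownianFiltration σB :=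
    isStronglyProgressive_trunc (isStronglyProgressive_const _ _) hσ'
  have hbXp : IsStronglyProgressive brownianFiltration bX :=
    isStronglyProgressive_trunc (isStronglyProgressive_comp_pair hXp hYp measurable_loewnerReDrift) hσ'
  have haAp : IsStronglyProgressive brownianFiltration aA :=
    isStronglyProgressive_trunc (isStronglyProgressive_comp_pair hXp hYp measurable_loewnerInvImDrift) hσ'
  have hσwp : IsStronglyProgressive brownianFiltration σw := hσBp.mul hAp
  have hσGp : IsStronglyProgressive brownianFiltration σG := hσwp.mul hG1p
  have hσwbd : ∀ t ω, |σw t ω| ≤ Real.sqrt κ * ((n + 2) / z.im) := fun t ω ↦ by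
    simp only [hσwdef]; rw [abs_mul]
    exact mul_le_mul (hσBbd t ω) (hAbd t ω) (abs_nonneg _) (Real.sqrt_nonneg _)
  have hσGbd : ∀ t ω, |σG t ω| ≤ Real.sqrt κ * ((n + 2) / z.im) * C1 := fun t ω ↦ by
    simp only [hσGdef]; rw [abs_mul]
    exact mul_le_mul (hσwbd t ω) (hC1 _ (hwmem t ω)) (abs_nonneg _) (by positivity)
  ---------------------------------------------------------------------------
  -- Step 1: `x^σ` is an Itô process
  have hX : IsItoProcess X bX σB brownian brownianFiltration preWienerMeasure :=
    isItoProcess_stoppedProcess_slePointRe hz hσ hσρ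
  ---------------------------------------------------------------------------
  -- Step 2: `w = x · (1/y)` is an Itô process (product rule)
  obtain ⟨KX, hKX, hKXM⟩ := exists_isItoIntegral_of_abs_le (hσBp.mul hXp)
    (C := Real.sqrt κ * (S * z.im)) fun t ω ↦ by
      rw [abs_mul]; exact mul_le_mul (hσBbd t ω) (hXbd t ω) (abs_nonneg _) (Real.sqrt_nonneg _)
  obtain ⟨K, hK, hKM⟩ := exists_isItoIntegral_of_abs_le (hσBp.mul hAp)
    (C := Real.sqrt κ * ((n + 2) / z.im)) fun t ω ↦ by
      rw [abs_mul]; exact mul_le_mul (hσBbd t ω) (hAbd t ω) (abs_nonneg _) (Real.sqrt_nonneg _)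
  have hA0 : ∀ ω, A 0 ω = (z.im)⁻¹ := fun ω ↦ by
    simp only [hAdef, hYdef]; rw [stoppedProcess_slePointIm_zero hz]
  have hAeq : ∀ᵐ ω ∂preWienerMeasure, ∀ t : ℝ≥0, A t ω = A 0 ω + ∫ s in (0 : ℝ)..t, aA s.toNNReal ω :=
    ae_of_all _ fun ω t ↦ by
      rw [hA0]
      exact inv_stoppedProcess_slePointIm_eq_integral hz hσρ t ω
  have haA : ∀ᵐ ω ∂preWienerMeasure, ∀ t : ℝ≥0,
      IntegrableOn (fun s : ℝ ↦ aA s.toNNReal ω) (Icc 0 t) :=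
    ae_of_all _ fun ω t ↦ integrableOn_trunc_loewnerInvImDrift hz hσρ ω _ isCompact_Icc
  have hw : IsItoProcess w bw σw brownian brownianFiltration preWienerMeasure :=
    IsItoProcess.mul_timeIntegral hXa hXc hσBp hX hAa hAc hAeq haA hKX hKXM hK hKM
  ---------------------------------------------------------------------------
  -- Step 3: `h(w)` is an Itô process (Itô's formula)
  obtain ⟨Kw, hKw, hKwM⟩ := exists_isItoIntegral_of_abs_le hσGp hσGbd
  have hf' : ContDiff ℝ 2 (Function.uncurry fun (_ : ℝ) (v : ℝ) ↦ h v) := hcont.comp contDiff_snd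
  have hito := ito_formula_itoProcess_ae_holds (fun (_ : ℝ) (v : ℝ) ↦ h v) hf'
    (fun t ↦ (hwa t).measurable) hσwp hw (K := Kw) (by exact hKw)
  have hGint := hw.ae_integrableOn_itoDrift hf' hσwp
  have hG : IsItoProcess (fun t ω ↦ h (w t ω)) D1 σG brownian brownianFiltration preWienerMeasure := by
    refine ⟨?_, Kw, hKw, ?_⟩
    · filter_upwards [hGint] with ω hω t
      have h1 := hω t
      simp only [deriv_const, zero_add] at h1
      exact h1
    · filter_upwards [hito] with ω hω t
      have h1 := hω t
      simp only [deriv_const, zero_add] at h1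
      exact h1
  ---------------------------------------------------------------------------
  -- Step 4: the product `h(w) ψ^a` (product rule again)
  obtain ⟨KX', hKX', hKX'M⟩ := exists_isItoIntegral_of_abs_le (hσGp.mul hGp)
    (C := Real.sqrt κ * ((n + 2) / z.im) * C1 * C0) fun t ω ↦ by
      rw [abs_mul]; exact mul_le_mul (hσGbd t ω) (hC0 _ (hwmem t ω)) (abs_nonneg _) (by positivity)
  obtain ⟨K', hK', hK'M⟩ := exists_isItoIntegral_of_abs_le (hσGp.mul hΨp)
    (C := Real.sqrt κ * ((n + 2) / z.im) * C1 * CΨ) fun t ω ↦ by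
      rw [abs_mul]; exact mul_le_mul (hσGbd t ω) (hΨbd t ω) (abs_nonneg _) (by positivity)
  have hΨ0 : ∀ ω, Ψ 0 ω = 1 := fun ω ↦ by
    simp only [hΨdef, hPdef]; rw [stoppedProcess_slePointPsi_zero hz, Real.one_rpow]
  have hΨeq : ∀ᵐ ω ∂preWienerMeasure, ∀ t : ℝ≥0, Ψ t ω = Ψ 0 ω + ∫ s in (0 : ℝ)..t, aΨ s.toNNReal ω :=
    ae_of_all _ fun ω t ↦ by
      rw [hΨ0]
      exact stoppedProcess_slePointPsi_rpow_eq_integral hz hσρ a t ω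
  have haΨc : ∀ ω, Continuous fun r : ℝ ↦ a * loewnerLogDerivRate (X r.toNNReal ω) (Y r.toNNReal ω) *
      Ψ r.toNNReal ω := fun ω ↦
    (continuous_const.mul (continuous_loewnerLogDerivRate_comp ((hXc ω).comp continuous_real_toNNReal)
      ((hYc ω).comp continuous_real_toNNReal) fun r ↦ hYpos _ ω)).mul
      ((hΨc ω).comp continuous_real_toNNReal)
  have haΨ : ∀ᵐ ω ∂preWienerMeasure, ∀ t : ℝ≥0,
      IntegrableOn (fun s : ℝ ↦ aΨ s.toNNReal ω) (Icc 0 t) :=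
    ae_of_all _ fun ω t ↦ integrableOn_trunc ((haΨc ω).continuousOn.integrableOn_compact isCompact_Icc)
  have hprod := ae_mul_eq_of_isItoProcess hGa hGc hσGp hG hΨa hΨc hΨeq haΨ hKX' hKX'M hK' hK'M
  ---------------------------------------------------------------------------
  -- Step 5: the drift of `h(w) ψ^a` vanishes identically, by (6.9)
  have hdrift : ∀ s ω, h (w s ω) * aΨ s ω + Ψ s ω * D1 s ω = 0 := by
    intro s ω
    by_cases hs : (s : WithTop ℝ≥0) ≤ σ ω
    · simp only [haΨdef, hD1def, hbwdef, hσwdef, hσBdef, hbXdef, haAdef, hwdef, hAdef, trunc_of_le hs]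
      exact rsObservable_itoDrift_eq_zero κ (hYpos s ω).ne'
        (rsGhatSlope_ode' hκ0 hdisc (X s ω * (Y s ω)⁻¹))
    · simp only [haΨdef, hD1def, hbwdef, hσwdef, hσBdef, hbXdef, haAdef, trunc_of_not_le hs]
      ring
  ---------------------------------------------------------------------------
  -- Step 6: `h(w) ψ^a = Ĝ(z) + K'` a.s., hence a martingale
  have hw0 : ∀ ω, w 0 ω = z.re / z.im := fun ω ↦ by
    simp only [hwdef, hAdef, hXdef, hYdef]
    rw [stoppedProcess_slePointRe_zero hz, stoppedProcess_slePointIm_zero hz, div_eq_mul_inv]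
  have hae : ∀ᵐ ω ∂preWienerMeasure, ∀ t : ℝ≥0,
      h (w t ω) * Ψ t ω = h (z.re / z.im) + K' t ω := by
    filter_upwards [hprod] with ω hω t
    have h1 := hω t
    simp only [hdrift, intervalIntegral.integral_zero, add_zero, hw0, hΨ0, mul_one] at h1
    exact h1
  have hMadapt : StronglyAdapted brownianFiltration fun t ω ↦ h (w t ω) * Ψ t ω := fun t ↦
    (hGa t).mul (hΨa t)
  have hmart : Martingale (fun t ω ↦ h (w t ω) * Ψ t ω) brownianFiltration preWienerMeasure := by
    have h1 : Martingale (fun t ω ↦ h (z.re / z.im) + K' t ω) brownianFiltration preWienerMeasure :=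
      (martingale_const brownianFiltration preWienerMeasure (h (z.re / z.im))).add hK'M
    refine h1.congr hMadapt fun t ↦ ?_
    filter_upwards [hae] with ω hω
    exact (hω t).symm
  ---------------------------------------------------------------------------
  -- Step 7: this is the stopped observable
  have heq : stoppedProcess (sleRSObservable κ a z) σ = fun t ω ↦ h (w t ω) * Ψ t ω := by
    funext t ω
    have hT := coe_untopA_min_lt_swallowingTime hz hσρ t ω
    have him : (centredMap (sleDriving κ ω) ((min (t : WithTop ℝ≥0) (σ ω)).untopA) z).im ≠ 0 :=
      (im_centredMap_pos (continuous_sleDriving κ ω) hz hT).ne'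
    rw [stoppedProcess, sleRSObservable, rsObservable_of_lt hT, rsGhat_eq_rsGhatSlope a κ him,
      ← cotArg_apply, ← hwcot, mul_comm]
    rfl
  rw [heq]
  exact hmart

end Main

end Literature.Probability.RandomPlanarGeometry
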